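import Mathlib
import HarnessLib
import Literature.MathematicalPhysics.QuantumLattice.ThinSectorFoldTwoRegimeSum
import Summits.HubbardSuperconductivity.HubbardSuperconductivity.Theorems.KLProgrammeH10TwoPointLimitPerturbedCountAntiThin
import Summits.HubbardSuperconductivity.HubbardSuperconductivity.Theorems.KLProgrammeH10TwoPointLimitPerturbedCountRowKill
import Summits.HubbardSuperconductivity.HubbardSuperconductivity.Theorems.KLProgrammeH10TwoPointLimitPerturbedCountForwardQuadratic
import Summits.HubbardSuperconductivity.HubbardSuperconductivity.Theorems.KLProgrammeH10TwoPointLimitPerturbedCountAlignedRigidity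
import Summits.HubbardSuperconductivity.HubbardSuperconductivity.Theorems.KLProgrammeH10TwoPointLimitPerturbedCountBridge

/-!
# Route `KLProgramme` — K3 engine child `KLRegimeEngineV17F2` (stmt-HubbardSuperconductivity-20437), stub (b) import ι₂:
# the THIN fold-range total on the perturbed curve (two-regime sum, no logarithm)

Cell gate-hubbard-kl, plan g17 (R41)(i) «E1-P2-THIN-COUNT» (seat p4; plan HOME/prover-p4/E1-P2-THIN-COUNT-PLAN.md §Refinement 4, part (F3c) on the
(β)-port curve).  The fold ranges of the anchored four-leg count, anchor `P = p_E(θ₁)` on the perturbed curve, at the thin affine tolerance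
`δ_s + δ₁·t` along the anti-diagonal of the row `σ_s = w/2 + s·w/2` (`δ_s = C₀w² + C₂w·m_s`, `m_s` any lower bound of the distance of `σ_s` to the
forward point `θ₁ + π` modulo `2π`): the generic two-regime row sum `BandSectorCounting.sum_rows_two_regime_le` (`ThinSectorFoldTwoRegimeSum`) with its
row data discharged by the perturbed bricks — per-row count `count_anti_sigmaE_affine`, class (C) empty by the `M_Γ`-Lipschitz bound of the sum of
partials (`abs_G_sub_le`), the dichotomy `abs_alignment_ge_perturbed`, the kill `row_kill_anti_perturbed`, the aligned quadratic floor
(`aligned_rigidity_perturbed` + `diag_ge_sq_forward_perturbed` at the representative of `σ_s` nearest to `θ₁ + π`), the stratum `diag_key_perturbed`,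
the level count `count_levels_diagE`, and the slope/curvature bounds `abs_h3E_le` / `abs_diag_deriv2E_le` of the diagonal function.

* `exists_int_abs_sub_two_pi_le_of_abs_sin_half_le` (plumbing: `|sin(y/2)| ≤ ε ⇒ y ≡ 0 (mod 2π)` up to `πε`);
* **`count_anti_total_thin_perturbed`** — the fold-range total at the thin tolerance, in the named constants (`pc*`).

Everything is PROVED; no definitions.  References: BGM 2006 Lemma 3.1 / (2.80) / App. A2–A3 [cite: BenfattoGiulianiMastropietro2006]; Mastropietro
2008 (14.67) p. 223 (anisotropic sectors: no `|h|`), p. 229 [cite: Mastropietro2008].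
-/

noncomputable section

namespace Summit.HubbardSuperconductivity.HubbardSuperconductivity.Theorems.PerturbedFermiCurve

set_option linter.dupNamespace false -- summit = problem name (single-conjunct summit), D-0017

open Real Set
open Literature.MathematicalPhysics.QuantumLattice Literature.MathematicalPhysics.QuantumLattice.BandSectorCounting

/-- `|sin(y/2)| ≤ ε` ⇒ `|y − k·2π| ≤ π·ε` for some integer `k`. [folklore] -/
theorem exists_int_abs_sub_two_pi_le_of_abs_sin_half_le {y ε : ℝ} (h : |Real.sin (y / 2)| ≤ ε) :
    ∃ k : ℤ, |y - k * (2 * π)| ≤ π * ε := by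
  have hπ := Real.pi_pos
  obtain ⟨m, hm⟩ := exists_int_abs_sub_le_pi (y / 2)
  set z := y / 2 - m * (2 * π) with hz
  have hsz : |Real.sin z| ≤ ε := by rw [hz, Real.sin_sub_int_mul_two_pi]; exact h
  have hy : y = 2 * z + (2 * m : ℤ) * (2 * π) := by rw [hz]; push_cast; ring
  rcases near_zero_or_pi_of_abs_sin_le hm hsz with h1 | h1
  · refine ⟨2 * m, ?_⟩
    rw [hy, add_sub_cancel_right, abs_mul, abs_two]; linarith
  · rcases le_or_gt 0 z with hz0 | hz0
    · refine ⟨2 * m + 1, ?_⟩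
      rw [abs_of_nonneg hz0] at h1
      have e : y - ((2 * m + 1 : ℤ) : ℝ) * (2 * π) = -(2 * (π - z)) := by rw [hy]; push_cast; ring
      rw [e, abs_neg, abs_mul, abs_two, abs_of_nonneg (by linarith [abs_le.1 hm])]; linarith
    · refine ⟨2 * m - 1, ?_⟩
      rw [abs_of_neg hz0] at h1
      have e : y - ((2 * m - 1 : ℤ) : ℝ) * (2 * π) = 2 * (π + z) := by rw [hy]; push_cast; ring
      rw [e, abs_mul, abs_two, abs_of_nonneg (by linarith [abs_le.1 hm])]; linarith

section FoldThin

variable {a b : ℝ} (B : BandBounds a b) {δ : (Fin 2 → ℝ) → ℝ} (hδs : ContDiff ℝ 2 δ) (heven : ∀ k, δ (-k) = δ k)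
  {κ₀ κ₁ κ₂ μ : ℝ} (hδ : ∀ k : Fin 2 → ℝ, |δ k| ≤ κ₀) (hlo : a ≤ μ - κ₀) (hhi : μ + κ₀ ≤ b)
  (hκ : ∀ k : Fin 2 → ℝ, ‖fderiv ℝ δ k‖ ≤ κ₁) (hκ₁ : κ₁ < B.Dtmin) (hκ₂ : ∀ k : Fin 2 → ℝ, ‖fderiv ℝ (fderiv ℝ δ) k‖ ≤ κ₂)
  {u : ℝ → ℝ} (hu : ∀ θ, IsBandFermiRadius (μ - δ (u θ • dir θ)) θ (u θ))
include B hδs heven hδ hlo hhi hκ hκ₁ hκ₂ hu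

/-- **The thin fold-range total on the perturbed curve** (two-regime sum; anchor `P = p_E(θ₁)`, rows `σ_s = w/2 + s·w/2`, `s < 4N`, cells
`t = (i+1)w ≤ τ`; tolerance `(C₀w² + C₂w·m_s) + δ₁·t` with `m_s ≤ dist(σ_s − θ₁ − π, 2πℤ)`): the number of cells with `|h^E_P(σ_s − t/2, σ_s + t/2)|`
within tolerance and `|∂₂h^E + ∂₃h^E| ≤ 2λ` is bounded by the two-regime expression of `sum_rows_two_regime_le` — `O(1/w)` once `δ₁, C₀w², C₂w·m ≍ w`,
NO `J+1`, NO `log N`.  Hypotheses: the fold smallness at `(λ, η₀F, τ)` (per-row count) and at `(η₁″/2, η₀K, τ)` (kill), the stratum `pcDiag(η₀S, η₁S) ≤ 2h_min`,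
thresholds `η₀″ + M_diag R ≤ η₀S`, `η₁″ + A_diag R ≤ η₁S`, `η₁″ ≤ h_min R/2`, the class-(C) gap `2λ + M_Γτ ≤ η₁″`, the dichotomy/rigidity margins at
`e₃ = η₀″/Dt + 2κ₀/Dt + s_max C_g ε₄(η₁″/2, η₀″)`, and the forward window `A_diag m₁ ≤ η₁S`, `A_diag m₁² ≤ η₀S`, `m₁ = π·(πe₃/(√2 u_min))`.
[cite: BenfattoGiulianiMastropietro2006, Lemma 3.1 / (2.80) / App. A2–A3] -/
theorem count_anti_total_thin_perturbed {θ₁ w C₀ C₂ δ₁ τ lam η₀F η₀K η₀'' η₁'' η₀S η₁S R mM : ℝ} {N : ℕ} (m : ℕ → ℝ)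
    (hw : 0 < w) (hN : (N : ℝ) * w = 2 * π) (hC₀ : 0 < C₀) (hC₂ : 0 ≤ C₂) (hδ₁ : 0 ≤ δ₁) (hτ : 0 < τ) (hlam : 0 < lam)
    (hm : ∀ s, 0 ≤ m s ∧ m s ≤ mM) (hmrep : ∀ (s : ℕ) (k : ℤ), m s ≤ |w / 2 + s * (w / 2) - k * (2 * π) - θ₁ - π|)
    -- the per-row fold count
    (hη₀F : 0 < η₀F) (hδηF : (C₀ * w ^ 2 + C₂ * w * mM) + δ₁ * τ ≤ η₀F / 2) (hloF : a ≤ μ - κ₀ - η₀F) (hhiF : μ + κ₀ + η₀F ≤ b)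
    (hevenF : pcEven B κ₀ κ₁ κ₂ lam η₀F τ ≤ B.hmin / 2)
    -- the stratum and the levels
    (hη₀S : 0 < η₀S) (hη₁S : 0 < η₁S) (hloS : a ≤ μ - κ₀ - η₀S) (hhiS : μ + κ₀ + η₀S ≤ b)
    (hdiagS : pcDiag B κ₀ κ₁ κ₂ η₀S η₁S ≤ 2 * B.hmin)
    -- the near-critical thresholds
    (hη₀'' : 0 < η₀'') (hR : 0 < R) (hthr₀ : η₀'' + pcMdiag B κ₁ * R ≤ η₀S) (hthr₁ : η₁'' + pcAdiag B κ₁ κ₂ * R ≤ η₁S)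
    (hthr₂ : η₁'' ≤ 2 * B.hmin * R / 4) (hlo'' : a ≤ μ - κ₀ - η₀'') (hhi'' : μ + κ₀ + η₀'' ≤ b)
    (hCgap : 2 * lam + pcMG B κ₁ κ₂ * τ ≤ η₁'')
    -- dichotomy / rigidity margins
    (hρ3 : 2 * (η₀'' / B.Dtmin + 2 * κ₀ / B.Dtmin + B.smax * (B.Cg * pcE4 B κ₀ κ₁ (η₁'' / 2) η₀'')) < B.rhomin ^ 2)
    (hhalf3 : η₀'' / B.Dtmin + 2 * κ₀ / B.Dtmin + B.smax * (B.Cg * pcE4 B κ₀ κ₁ (η₁'' / 2) η₀'') < 1 / 2)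
    (hmargin3 : π * (η₀'' / B.Dtmin + 2 * κ₀ / B.Dtmin + B.smax * (B.Cg * pcE4 B κ₀ κ₁ (η₁'' / 2) η₀'')) + 2 * umklappRadius b < 2 * π)
    (hm₁ : pcAdiag B κ₁ κ₂ * (π * (π * (η₀'' / B.Dtmin + 2 * κ₀ / B.Dtmin + B.smax * (B.Cg * pcE4 B κ₀ κ₁ (η₁'' / 2) η₀'')) /
      (Real.sqrt 2 * B.umin))) ≤ η₁S)
    (hm₁' : pcAdiag B κ₁ κ₂ * (π * (π * (η₀'' / B.Dtmin + 2 * κ₀ / B.Dtmin + B.smax * (B.Cg * pcE4 B κ₀ κ₁ (η₁'' / 2) η₀'')) /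
      (Real.sqrt 2 * B.umin))) ^ 2 ≤ η₀S)
    -- the kill
    (hη₀K : 2 * η₀'' ≤ η₀K) (hloK : a ≤ μ - κ₀ - η₀K) (hhiK : μ + κ₀ + η₀K ≤ b)
    (hevenK : pcEven B κ₀ κ₁ κ₂ (η₁'' / 2) η₀K τ ≤ B.hmin / 2)
    (hρK : 2 * (η₀K / B.Dtmin + 2 * κ₀ / B.Dtmin +
      B.smax * (B.Cg * pcE4 B κ₀ κ₁ (2 * (η₁'' / 2) + (4 + κ₁) * pcAE B κ₁ κ₂ * τ / 2) η₀K + τ / 2)) < B.rhomin ^ 2)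
    (hτηK : pcManti B κ₁ κ₂ * τ ^ 2 ≤ η₀K / 2) (hτlamK : pcMG B κ₁ κ₂ * τ ≤ 2 * (η₁'' / 2))
    (hιK : 3 * pcSE B κ₁ * τ < B.rhomin ^ 2 - 2 * (η₀'' / B.Dtmin + 2 * κ₀ / B.Dtmin + B.smax * (B.Cg * pcE4 B κ₀ κ₁ (η₁'' / 2) η₀''))) :
    ∑ s ∈ Finset.range (4 * N), ((((Finset.range ⌊τ / w⌋₊).filter fun i : ℕ =>
        |hfunE δ u μ (XE u θ₁, YE u θ₁) (w / 2 + s * (w / 2) - (w + i * w) / 2) (w / 2 + s * (w / 2) + (w + i * w) / 2)| ≤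
            (C₀ * w ^ 2 + C₂ * w * m s) + δ₁ * (w + i * w) ∧
        |h3E δ u (XE u θ₁, YE u θ₁) (w / 2 + s * (w / 2) + (w + i * w) / 2) (w / 2 + s * (w / 2) - (w + i * w) / 2) +
          h3E δ u (XE u θ₁, YE u θ₁) (w / 2 + s * (w / 2) - (w + i * w) / 2) (w / 2 + s * (w / 2) + (w + i * w) / 2)| ≤ 2 * lam).card : ℝ)) ≤
      (4 * N : ℕ) * ((2 * (τ / min (η₀F / (2 * pcManti B κ₁ κ₂ * τ)) (2 * lam / pcMG B κ₁ κ₂) + 1) +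
            4 * (τ / min (η₀F / (2 * pcManti B κ₁ κ₂ * τ)) (2 * lam / pcMG B κ₁ κ₂) + 1) * δ₁ / (B.hmin / 2 * w)) +
          (2 * (τ / min (η₀F / (2 * pcManti B κ₁ κ₂ * τ)) (2 * lam / pcMG B κ₁ κ₂) + 1) / w) *
            (2 * (C₀ * w ^ 2 + C₂ * w * mM) * Real.sqrt (2 * pcManti B κ₁ κ₂) / (B.hmin / 2 * Real.sqrt η₀'')) +
          (4 * (τ / min (η₀F / (2 * pcManti B κ₁ κ₂ * τ)) (2 * lam / pcMG B κ₁ κ₂) + 1) * Real.sqrt (2 * pcManti B κ₁ κ₂) / (B.hmin / 2)) *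
            (Real.sqrt (C₀ / 2) + C₂ / Real.sqrt B.hmin)) +
        (2 * (τ / min (η₀F / (2 * pcManti B κ₁ κ₂ * τ)) (2 * lam / pcMG B κ₁ κ₂) + 1) / w) * (2 * Real.sqrt ((C₀ * w ^ 2 + C₂ * w * mM) / (B.hmin / 2))) *
          ((32 * (4 * π / min (η₀S / (2 * pcMdiag B κ₁)) (η₁S / (4 * pcAdiag B κ₁ κ₂)) + 1) / η₁S + 16 * π / η₀S) *
              (2 * ((C₀ * w ^ 2 + C₂ * w * mM) + δ₁ * τ)) / w +
            (8 * (4 * π / min (η₀S / (2 * pcMdiag B κ₁)) (η₁S / (4 * pcAdiag B κ₁ κ₂)) + 1) / Real.sqrt (2 * B.hmin)) *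
              Real.sqrt (2 * ((C₀ * w ^ 2 + C₂ * w * mM) + δ₁ * τ)) / w +
            2 * (4 * π / min (η₀S / (2 * pcMdiag B κ₁)) (η₁S / (4 * pcAdiag B κ₁ κ₂)) + 1)) +
        (2 * (τ / min (η₀F / (2 * pcManti B κ₁ κ₂ * τ)) (2 * lam / pcMG B κ₁ κ₂) + 1) / w) *
          (2 * (C₀ * w ^ 2 + C₂ * w * mM) * Real.sqrt (2 * pcManti B κ₁ κ₂) / (B.hmin / 2)) *
          ((4 * ((4 * N : ℕ) * (w / 2)) / R + 1) * (4 / Real.sqrt (2 * C₀ * w ^ 2) + 11 / (Real.sqrt (2 * B.hmin) * (w / 2)))) := by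
  have h2ne : (2 : WithTop ℕ∞) ≠ 0 := by norm_num
  have hδ' : ∀ k : Fin 2 → ℝ, (∀ i, |k i| ≤ π) → |δ k| ≤ κ₀ := fun k _ => hδ k
  have hκ' : ∀ k : Fin 2 → ℝ, (∀ i, |k i| ≤ π) → ‖fderiv ℝ δ k‖ ≤ κ₁ := fun k _ => hκ k
  have hκ₁0 : 0 ≤ κ₁ := (norm_nonneg _).trans (hκ 0)
  have hκ₂0 : 0 ≤ κ₂ := (norm_nonneg (fderiv ℝ (fderiv ℝ δ) 0)).trans (hκ₂ 0)
  obtain ⟨-, hSE, -, -, hAE, hMG, hMa, hMd, hAd⟩ := pc_pos B hκ₁0 hκ₁ hκ₂0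
  have hs := B.smax_pos; have hh := B.hmin_pos; have hDt := B.Dtmin_pos; have hπ := Real.pi_pos
  set P : ℝ × ℝ := (XE u θ₁, YE u θ₁) with hP
  set E3 := η₀'' / B.Dtmin + 2 * κ₀ / B.Dtmin + B.smax * (B.Cg * pcE4 B κ₀ κ₁ (η₁'' / 2) η₀'') with hE3
  set m₁ := π * (π * E3 / (Real.sqrt 2 * B.umin)) with hm₁def
  -- the second derivative of the diagonal function
  set G2 : ℝ → ℝ := fun x => 8 * (Real.cos (SXE u P x x) * VXE u x ^ 2 + Real.cos (SYE u P x x) * VYE u x ^ 2) +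
        4 * (Real.sin (SXE u P x x) * (deriv (deriv u) x * Real.cos x - 2 * deriv u x * Real.sin x - u x * Real.cos x) +
          Real.sin (SYE u P x x) * (deriv (deriv u) x * Real.sin x + 2 * deriv u x * Real.cos x - u x * Real.sin x)) +
        (4 * fderiv ℝ (fderiv ℝ δ) (momE u P x x) ![VXE u x, VYE u x] ![VXE u x, VYE u x] +
          2 * fderiv ℝ δ (momE u P x x) ![(deriv (deriv u) x * Real.cos x - 2 * deriv u x * Real.sin x - u x * Real.cos x),
            (deriv (deriv u) x * Real.sin x + 2 * deriv u x * Real.cos x - u x * Real.sin x)]) with hG2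
  have hg : ∀ z, HasDerivAt (fun x => hfunE δ u μ P x x) ((fun x => 2 * h3E δ u P x x) z) z :=
    hasDerivAt_hfunE_diagZero B hδs hδ hlo hhi hκ hκ₁ hu P
  have hg' : ∀ z, HasDerivAt (fun x => 2 * h3E δ u P x x) (G2 z) z := hasDerivAt_two_h3E_diag B hδs hδ hlo hhi hκ hκ₁ hu P
  have hM₁ : ∀ z, |(fun x => 2 * h3E δ u P x x) z| ≤ pcMdiag B κ₁ := by
    intro z
    have h1 : |h3E δ u P z z| ≤ (4 + κ₁) * pcSE B κ₁ := abs_h3E_le B hδs hδ hlo hhi hκ hκ₁ hu P z z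
    show |2 * h3E δ u P z z| ≤ 2 * ((4 + κ₁) * pcSE B κ₁)
    rw [abs_mul, abs_two]; linarith only [h1]
  have hA : ∀ z, |G2 z| ≤ pcAdiag B κ₁ κ₂ := fun z => abs_diag_deriv2E_le B hδs hδ hlo hhi hκ hκ₁ hκ₂ hu P z
  have hstrat : ∀ z, |(fun x => hfunE δ u μ P x x) z| ≤ η₀S → |(fun x => 2 * h3E δ u P x x) z| ≤ η₁S → 2 * B.hmin ≤ G2 z :=
    fun z hz hz' => diag_key_perturbed B hδs hδ hlo hhi hκ hκ₁ hκ₂ hu hloS hhiS hz hz' hdiagS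
  -- rows
  set σf : ℕ → ℝ := fun s => w / 2 + s * (w / 2) with hσf
  set D : ℕ → ℝ := fun s => hfunE δ u μ P (σf s) (σf s) with hDdef
  set I : ℕ → ℝ := fun s => Real.sin (SXE u P (σf s) (σf s)) * Real.sin (XE u (σf s)) + Real.sin (SYE u P (σf s) (σf s)) * Real.sin (YE u (σf s))
    with hIdef
  set Acnt : ℕ → ℝ := fun s => ((((Finset.range ⌊τ / w⌋₊).filter fun i : ℕ =>
        |hfunE δ u μ P (σf s - (w + i * w) / 2) (σf s + (w + i * w) / 2)| ≤ (C₀ * w ^ 2 + C₂ * w * m s) + δ₁ * (w + i * w) ∧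
        |h3E δ u P (σf s + (w + i * w) / 2) (σf s - (w + i * w) / 2) + h3E δ u P (σf s - (w + i * w) / 2) (σf s + (w + i * w) / 2)| ≤ 2 * lam).card : ℝ))
    with hAcnt
  set ℓ₅ := min (η₀F / (2 * pcManti B κ₁ κ₂ * τ)) (2 * lam / pcMG B κ₁ κ₂) with hℓ₅
  have hℓ₅0 : 0 < ℓ₅ := lt_min (by positivity) (by positivity)
  set Pc := τ / ℓ₅ + 1 with hPcdef
  have hPc0 : 0 ≤ Pc := by rw [hPcdef]; positivity
  have hK₀τ : (⌊τ / w⌋₊ : ℝ) * w ≤ τ := by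
    have := Nat.floor_le (div_nonneg hτ.le hw.le) (a := τ / w)
    rwa [le_div_iff₀ hw] at this
  -- (hRow) the per-row affine fold count
  have hRow : ∀ s, s < 4 * N → Acnt s ≤ Pc * (2 * ((if |(fun x => hfunE δ u μ P x x) (w / 2 + s * (w / 2))| ≤ 2 * ((C₀ * w ^ 2 + C₂ * w * m s) + δ₁ * τ)
      then 2 * Real.sqrt ((C₀ * w ^ 2 + C₂ * w * m s) / (B.hmin / 2)) + 2 * δ₁ / (B.hmin / 2)
      else 2 * (C₀ * w ^ 2 + C₂ * w * m s) * Real.sqrt (2 * pcManti B κ₁ κ₂) / (B.hmin / 2 * Real.sqrt |(fun x => hfunE δ u μ P x x) (w / 2 + s * (w / 2))|) +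
        2 * δ₁ / (B.hmin / 2)) / w + 1)) := by
    intro s hs4
    obtain ⟨hm0, hmM⟩ := hm s
    have hδ₀ : 0 ≤ C₀ * w ^ 2 + C₂ * w * m s := by positivity
    have hδη : (C₀ * w ^ 2 + C₂ * w * m s) + δ₁ * τ ≤ η₀F / 2 := by
      have : C₂ * w * m s ≤ C₂ * w * mM := mul_le_mul_of_nonneg_left hmM (by positivity)
      linarith only [this, hδηF]
    have h := count_anti_sigmaE_affine B hδs hδ hlo hhi hκ hκ₁ hκ₂ hu (P := P) (σ := σf s) hw hδ₀ hδ₁ hlam hτ hη₀F hδη hloF hhiF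
      hevenF hMa hMG
    refine h.trans ?_
    have hL0 : 0 ≤ (if |hfunE δ u μ P (σf s) (σf s)| ≤ 2 * ((C₀ * w ^ 2 + C₂ * w * m s) + δ₁ * τ)
        then 2 * Real.sqrt ((C₀ * w ^ 2 + C₂ * w * m s) / (B.hmin / 2)) + 2 * δ₁ / (B.hmin / 2)
        else 2 * (C₀ * w ^ 2 + C₂ * w * m s) * Real.sqrt (2 * pcManti B κ₁ κ₂) / (B.hmin / 2 * Real.sqrt |hfunE δ u μ P (σf s) (σf s)|) +
          2 * δ₁ / (B.hmin / 2)) := by split_ifs <;> positivity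
    have hfac : (⌊τ / w⌋₊ : ℝ) * w / ℓ₅ + 1 ≤ Pc := by
      rw [hPcdef]; have := div_le_div_of_nonneg_right hK₀τ hℓ₅0.le; linarith only [this]
    exact mul_le_mul_of_nonneg_right hfac (by positivity)
  -- (hC) transversal-in-σ rows carry no cells
  have hC : ∀ s, s < 4 * N → η₁'' < |(fun x => 2 * h3E δ u P x x) (w / 2 + s * (w / 2))| → Acnt s ≤ 0 := by
    intro s _ hbig
    have hempty : ((Finset.range ⌊τ / w⌋₊).filter fun i : ℕ =>
        |hfunE δ u μ P (σf s - (w + i * w) / 2) (σf s + (w + i * w) / 2)| ≤ (C₀ * w ^ 2 + C₂ * w * m s) + δ₁ * (w + i * w) ∧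
        |h3E δ u P (σf s + (w + i * w) / 2) (σf s - (w + i * w) / 2) + h3E δ u P (σf s - (w + i * w) / 2) (σf s + (w + i * w) / 2)| ≤ 2 * lam) = ∅ := by
      rw [Finset.filter_eq_empty_iff]
      intro i hi hcell
      rw [Finset.mem_range] at hi
      have ht0 : 0 < w + i * w := by positivity
      have htτ : w + i * w ≤ τ := by
        have h1 : (i : ℝ) + 1 ≤ ⌊τ / w⌋₊ := by exact_mod_cast Nat.succ_le_of_lt hi
        have h2 := mul_le_mul_of_nonneg_right h1 hw.le
        linarith only [h2, hK₀τ]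
      have hLip : |(h3E δ u P (σf s + (w + i * w) / 2) (σf s - (w + i * w) / 2) + h3E δ u P (σf s - (w + i * w) / 2) (σf s + (w + i * w) / 2)) -
          (h3E δ u P (σf s + 0 / 2) (σf s - 0 / 2) + h3E δ u P (σf s - 0 / 2) (σf s + 0 / 2))| ≤ pcMG B κ₁ κ₂ * |(w + i * w) - 0| :=
        abs_G_sub_le B hδs hδ hlo hhi hκ hκ₁ hκ₂ hu P (σf s) (w + i * w) 0
      rw [zero_div, add_zero, sub_zero, sub_zero, abs_of_pos ht0] at hLip
      have hG0 : h3E δ u P (σf s) (σf s) + h3E δ u P (σf s) (σf s) = 2 * h3E δ u P (σf s) (σf s) := by ring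
      rw [hG0] at hLip
      have hbig' : η₁'' < |2 * h3E δ u P (σf s) (σf s)| := hbig
      have htri := abs_sub_abs_le_abs_sub (2 * h3E δ u P (σf s) (σf s))
        (h3E δ u P (σf s + (w + i * w) / 2) (σf s - (w + i * w) / 2) + h3E δ u P (σf s - (w + i * w) / 2) (σf s + (w + i * w) / 2))
      rw [abs_sub_comm] at htri
      have hMGτ : pcMG B κ₁ κ₂ * (w + i * w) ≤ pcMG B κ₁ κ₂ * τ := mul_le_mul_of_nonneg_left htτ hMG.le
      linarith only [hcell.2, hLip, hbig', htri, hMGτ, hCgap]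
    have e : Acnt s = 0 := by rw [hAcnt]; dsimp only; rw [hempty, Finset.card_empty, Nat.cast_zero]
    rw [e]
  -- (hDich) the alignment dichotomy
  have hdich0 : ∀ s, |D s| ≤ η₀'' → |2 * h3E δ u P (σf s) (σf s)| ≤ η₁'' → B.rhomin ^ 2 - 2 * E3 ≤ |I s| := by
    intro s hDs hD's
    have hH' : |h3E δ u P (σf s) (σf s)| ≤ η₁'' / 2 := by
      rw [abs_mul, abs_two] at hD's; linarith only [hD's]
    exact abs_alignment_ge_perturbed B hδs hδ hlo hhi hκ hκ₁ hu hlo'' hhi'' hDs hH'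
  have hι0 : 0 < B.rhomin ^ 2 - 2 * E3 := by
    have : 0 < 3 * pcSE B κ₁ * τ := by positivity
    linarith only [this, hιK]
  have hDich : ∀ s, s < 4 * N → |(fun x => hfunE δ u μ P x x) (w / 2 + s * (w / 2))| ≤ η₀'' →
      |(fun x => 2 * h3E δ u P x x) (w / 2 + s * (w / 2))| ≤ η₁'' → 0 < I s ∨ I s < 0 := by
    intro s _ hDs hD's
    have h := hdich0 s hDs hD's
    rcases lt_trichotomy (I s) 0 with hl | he | hg0
    · exact Or.inr hl
    · exfalso; rw [he, abs_zero] at h; linarith only [h, hι0]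
    · exact Or.inl hg0
  -- (hKill) anti-aligned rows with `D > δ′` carry no cells
  have hKill : ∀ s, s < 4 * N → I s < 0 → |(fun x => hfunE δ u μ P x x) (w / 2 + s * (w / 2))| ≤ η₀'' →
      |(fun x => 2 * h3E δ u P x x) (w / 2 + s * (w / 2))| ≤ η₁'' → (C₀ * w ^ 2 + C₂ * w * m s) + δ₁ * τ < (fun x => hfunE δ u μ P x x) (w / 2 + s * (w / 2)) →
      Acnt s ≤ 0 := by
    intro s _ hanti hDs hD's hDlo
    obtain ⟨hm0, hmM⟩ := hm s
    have hδ₀ : 0 ≤ C₀ * w ^ 2 + C₂ * w * m s := by positivity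
    have hIabs := hdich0 s hDs hD's
    have hIneg : B.rhomin ^ 2 - 2 * E3 ≤ -I s := by rw [abs_of_neg hanti] at hIabs; exact hIabs
    -- the alignment functional along the window
    have hud : ∀ z, DifferentiableAt ℝ u z := fun z => (differentiableAt_root_and_deriv B hδs hδ hlo hhi hκ hκ₁ hu z).1
    have hIwin : ∀ x ∈ Icc (σf s - τ / 2) (σf s + τ / 2),
        B.rhomin ^ 2 - 2 * E3 - pcSE B κ₁ * τ ≤ -(Real.sin (SXE u P (σf s) (σf s)) * Real.sin (XE u x) + Real.sin (SYE u P (σf s) (σf s)) * Real.sin (YE u x)) := by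
      intro x hx
      obtain ⟨hX, hY⟩ := abs_XE_sub_XE_le B hδs hδ hlo hhi hκ hκ₁ hu x (σf s)
      have hxσ : |x - σf s| ≤ τ / 2 := by rw [abs_le]; constructor <;> linarith only [hx.1, hx.2]
      have d1 : |Real.sin (SXE u P (σf s) (σf s)) * (Real.sin (XE u x) - Real.sin (XE u (σf s)))| ≤ pcSE B κ₁ * (τ / 2) := by
        rw [abs_mul]
        calc |Real.sin (SXE u P (σf s) (σf s))| * |Real.sin (XE u x) - Real.sin (XE u (σf s))| ≤ 1 * |XE u x - XE u (σf s)| :=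
              mul_le_mul (Real.abs_sin_le_one _) (Real.abs_sin_sub_sin_le _ _) (abs_nonneg _) zero_le_one
          _ ≤ pcSE B κ₁ * (τ / 2) := by rw [one_mul]; exact hX.trans (mul_le_mul_of_nonneg_left hxσ hSE.le)
      have d2 : |Real.sin (SYE u P (σf s) (σf s)) * (Real.sin (YE u x) - Real.sin (YE u (σf s)))| ≤ pcSE B κ₁ * (τ / 2) := by
        rw [abs_mul]
        calc |Real.sin (SYE u P (σf s) (σf s))| * |Real.sin (YE u x) - Real.sin (YE u (σf s))| ≤ 1 * |YE u x - YE u (σf s)| :=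
              mul_le_mul (Real.abs_sin_le_one _) (Real.abs_sin_sub_sin_le _ _) (abs_nonneg _) zero_le_one
          _ ≤ pcSE B κ₁ * (τ / 2) := by rw [one_mul]; exact hY.trans (mul_le_mul_of_nonneg_left hxσ hSE.le)
      have e : Real.sin (SXE u P (σf s) (σf s)) * Real.sin (XE u x) + Real.sin (SYE u P (σf s) (σf s)) * Real.sin (YE u x) =
          I s + (Real.sin (SXE u P (σf s) (σf s)) * (Real.sin (XE u x) - Real.sin (XE u (σf s))) +
            Real.sin (SYE u P (σf s) (σf s)) * (Real.sin (YE u x) - Real.sin (YE u (σf s)))) := by rw [hIdef]; ring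
      rw [e]
      have d1' := (abs_le.1 d1).2; have d2' := (abs_le.1 d2).2
      linarith only [d1', d2', hIneg]
    have hι : 2 * pcSE B κ₁ * τ < B.rhomin ^ 2 - 2 * E3 - pcSE B κ₁ * τ := by linarith only [hιK]
    have hDhi : hfunE δ u μ P (σf s) (σf s) ≤ η₀K / 2 := (le_abs_self _).trans (hDs.trans (by linarith only [hη₀K]))
    have hG0 : |h3E δ u P (σf s) (σf s) + h3E δ u P (σf s) (σf s)| ≤ 2 * (η₁'' / 2) := by
      have e : h3E δ u P (σf s) (σf s) + h3E δ u P (σf s) (σf s) = 2 * h3E δ u P (σf s) (σf s) := by ring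
      rw [e]; have h1 : |2 * h3E δ u P (σf s) (σf s)| ≤ η₁'' := hD's; linarith only [h1]
    have hkill := row_kill_anti_perturbed B hδs hδ hlo hhi hκ hκ₁ hκ₂ hu (P := P) (σ := σf s) hw hτ hδ₀ hδ₁ hloK hhiK hevenK hρK hMa hMG
      hτηK hτlamK hDlo hDhi hG0 hIwin hι
    have hsub := Finset.card_le_card (Finset.monotone_filter_right (Finset.range ⌊τ / w⌋₊)
      (fun (i : ℕ) (_ : i ∈ Finset.range ⌊τ / w⌋₊) (hi :
        |hfunE δ u μ P (σf s - (w + i * w) / 2) (σf s + (w + i * w) / 2)| ≤ (C₀ * w ^ 2 + C₂ * w * m s) + δ₁ * (w + i * w) ∧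
        |h3E δ u P (σf s + (w + i * w) / 2) (σf s - (w + i * w) / 2) + h3E δ u P (σf s - (w + i * w) / 2) (σf s + (w + i * w) / 2)| ≤ 2 * lam) => hi.1))
    rw [hkill] at hsub
    have e : Acnt s = 0 := by rw [hAcnt]; dsimp only; exact_mod_cast Nat.le_zero.1 hsub
    rw [e]
  -- (hAli) aligned rows: the quadratic floor at the nearest representative of the forward point
  have hAli : ∀ s, s < 4 * N → 0 < I s → |(fun x => hfunE δ u μ P x x) (w / 2 + s * (w / 2))| ≤ η₀'' →
      |(fun x => 2 * h3E δ u P x x) (w / 2 + s * (w / 2))| ≤ η₁'' → B.hmin * m s ^ 2 ≤ (fun x => hfunE δ u μ P x x) (w / 2 + s * (w / 2)) := by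
    intro s _ hal hDs hD's
    obtain ⟨hm0, -⟩ := hm s
    have hH' : |h3E δ u P (σf s) (σf s)| ≤ η₁'' / 2 := by
      have h1 : |2 * h3E δ u P (σf s) (σf s)| ≤ η₁'' := hD's
      rw [abs_mul, abs_two] at h1; linarith only [h1]
    have hrig := aligned_rigidity_perturbed B hδs hδ hlo hhi hκ hκ₁ hu heven hlo'' hhi'' hDs hH' hal hρ3 hhalf3 hmargin3
    obtain ⟨k, hk⟩ := exists_int_abs_sub_two_pi_le_of_abs_sin_half_le (y := σf s - θ₁ - π) hrig
    set σ' := σf s - k * (2 * π) with hσ'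
    have hm' : |σ' - θ₁ - π| ≤ m₁ := by
      rw [hσ', hm₁def]; rw [show w / 2 + s * (w / 2) - k * (2 * π) - θ₁ - π = (σf s - θ₁ - π) - k * (2 * π) by rw [hσf]; ring]  -- noqa
      exact hk
    have hfwd := diag_ge_sq_forward_perturbed B hδs heven hδ hlo hhi hκ hκ₁ hκ₂ hu (θ₁ := θ₁) (σ := σ') hloS hhiS hdiagS hm' hm₁ hm₁'
    have hper : hfunE δ u μ P σ' σ' = hfunE δ u μ P (σf s) (σf s) := by
      have e : σf s = σ' + k * (2 * π) := by rw [hσ']; ring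
      rw [e, hfunE_add_int_mul_two_pi_two B hδs hδ hlo hhi hκ hκ₁ hu, hfunE_add_int_mul_two_pi_three B hδs hδ hlo hhi hκ hκ₁ hu]
    have hmle : m s ≤ |σ' - θ₁ - π| := by
      have := hmrep s k; rw [hσ']; convert this using 2
    have hsq : m s ^ 2 ≤ (σ' - θ₁ - π) ^ 2 := by
      rw [← sq_abs (σ' - θ₁ - π)]; exact pow_le_pow_left₀ hm0 hmle 2
    show B.hmin * m s ^ 2 ≤ hfunE δ u μ P (σf s) (σf s)
    rw [← hper]
    exact (mul_le_mul_of_nonneg_left hsq hh.le).trans hfwd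
  -- (hLev) one fat level of the diagonal level count
  have hηB : 0 < 2 * ((C₀ * w ^ 2 + C₂ * w * mM) + δ₁ * τ) := by
    obtain ⟨h0, h1⟩ := hm 0
    have : 0 ≤ C₂ * w * mM := by have := h0.trans h1; positivity
    positivity
  have hLev := count_levels_diagE B hδs hδ hlo hhi hκ hκ₁ hκ₂ hu (P := P) hw hN hηB hη₀S hη₁S hloS hhiS hdiagS hMd hAd
  -- assemble
  have hmain := sum_rows_two_regime_le (hg := hg) (hg' := hg') (hc₂ := by positivity) (hR := hR) (hη₀'' := hη₀'') (hM₁ := hM₁) (hA := hA)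
    (hstrat := hstrat) (hη₀ := hthr₀) (hη₁ := hthr₁) (hη₁R := hthr₂) (x₀ := w / 2) (h := w / 2) (hh := by positivity) (N := 4 * N)
    (Acnt := Acnt) (m := m) (Ali := fun s => 0 < I s) (Anti := fun s => I s < 0) (hw := hw) (hC₀ := hC₀) (hC₂ := hC₂) (hδ₁ := hδ₁) (hτ := hτ)
    (hPc := hPc0) (hc := half_pos hh) (hM := hMa) (hcQ := hh) (hm := hm) (hRow := hRow) (hC := hC) (hDich := hDich) (hKill := hKill) (hAli := hAli)
    (hLev := hLev)
  exact hmain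

end FoldThin

end Summit.HubbardSuperconductivity.HubbardSuperconductivity.Theorems.PerturbedFermiCurve

end
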